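import Summits.ABC.IUTFork.Repair.CandInternal52
import Summits.ABC.IUTFork.Repair.Barrier
import HarnessLib

/-!
# IUT REPAIR branch (rung LADDER-ABC:A2.RP), sub-cell B0 class (i) INTERNAL, file `CandInternal55` (abc-iut-rp-d1, gen 3):
# THE CLASS-(i) DATUM-LEVEL SCHEMA over TRANSPORTER CLASSES, I — the schema, the d1 rows as instances, sufficiency via the Θ-shadow

Record file (D-0012) of the abc-iut cell's IUT REPAIR branch (seat abc-iut-rp-d1, k = 55 ≡ 1 (mod 3); REPAIR-SPEC v0.6a §3/§4, sub-cell
B0 = [EtTh] cyclotomic + constant-multiple rigidity rows RP-I03a/b, RP-I13, RP-I19 and print's own clause). TAKES NO SIDE on [IUTchIII]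
Cor. 3.12 or between Mochizuki / Scholze–Stix / Joshi; CANDIDATES ARE HYPOTHESES — the two definitions below are a PARAMETRISED READING
PREDICATE (`TransporterCompat`, the schema of which every datum-level class-(i) row is an instance) and a PARAMETRISED SET (`indShadow`),
never asserted; typed ≠ proved; instantiated ≠ endorsed. Sources read: [IUTchIII] Thm. 3.11 (iii) (c) final clause p. 158 l. 5–14 (print's
clause C = `Cor312Vol.PilotKummerCompat`, abc-iut-w5-d068 p420303); Rmk. 2.2.1 (ii) p. 67 l. 39–49, (iv) p. 69 l. 1–5; Rmk. 2.2.2 (ii) p. 70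
l. 33–36; Cor. 3.12 Step (x) p. 180 l. 53–57, (xi-a) p. 181 l. 36–41; [EtTh] Cor. 2.19 p. 58 l. 12 – p. 60 l. 6 (kurims `paper:url-b1bf576d3169`);
[SS2018] §2.2 pp. 9–10. Sequel (the pinned countermodel's two cosets, T-b/T-c, the packaged census): `Repair/CandInternal58`.
[claim: Mochizuki2012, status: disputed]

WHY. Generations 0–2 of this seat typed the class-(i) material row by row as constraints on HOW the link's isomorphisms act on the Θ-pilot's
Kummer data (binder `Λ : Set PacketAut`, abc-iut-w5-d155) joined with a transport clause RF1 «`qK = Φ₀·frobΨ_n m₀`, `Φ₀ ∈ Λ`», and found for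
EACH row that, `Λ` bound, the supplier collapses to print's clause with a RESTRICTED TRANSPORTER (`CandInternal10.exists_*_iff`,
`CandInternal31.exists_coric_H7_and_link_iff`, `CandInternal52.exists_HTor_linkSubInd_transport_iff`). Here the collapse is stated ONCE:
* §1 `TransporterCompat S P qK G := ∃ Φ ∈ G, ∃ m₀, qK = Φ·frobΨ_n m₀` — print's C is the instance `G = ⟨(Ind1) ∪ (Ind2)⟩`
  (`pilotKummerCompat_iff_transporterCompat`); EVERY Λ-row «(∀ Φ ∈ Λ, g Φ) ∧ RF1(Λ)» is, `Λ` bound, the instance `G = {Φ | g Φ}`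
  (`exists_pointwise_and_transport_iff`); the four d1 suppliers are the instances `G_I03a` (⟨Ind2⟩-translates on the Θ data), `G_I03b` (fixes
  the Θ data), `G_I13 = ⟨Ind2⟩`, `G_I19 = ⟨Ind⟩ ∩ finite-order-on-Θ-data` (`rowI03a_iff`, `rowI03b_iff`, `rowI13_iff`, `rowI19_iff`).
* §2 SUFFICIENCY BY THE Θ-SHADOW: `indShadow S P := {Φ | on every column Kummer image Φ acts as SOME indeterminacy does}`;
  `G ⊆ indShadow ⟹ TransporterCompat G ⟹ C ⟹ S` (`pilotKummerCompat_of_transporterCompat`; in abc-iut-rp-bar's vocabulary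
  `sufficient_of_subset_indShadow`), and the MAXIMAL such class gives back EXACTLY C (`transporterCompat_indShadow_iff`): **no transporter
  constraint that supplies S through its action on the theta data is weaker than print's own clause** — the class-(i) material can only
  RESTRICT print's transporter; all four d1 classes lie in `indShadow` (`rowClasses_subset_indShadow`).
READING (neutral; census ≠ verdict): the space of datum-level class-(i) candidates is the lattice of transporter classes, and the classes that
supply S through their Θ-action are exactly the sub-classes of print's clause; whether the Θ×μ_LGP-link's action on the containers lies in such
a class is the reading of the binder `Λ` (coric/(Ind2), Step (x) p. 180 l. 53–57, vs radial/value-group, [SS2018] §2.2) — located, not decided.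
[cite: ScholzeStix2018, §2.2 pp. 9–10]
-/

open Set

namespace Summit.ABC.IUTFork.Repair

open Thm311 Cor312 Cor312Vol Literature.IUT.LogThetaLattice

namespace CandInternal55

/-! ## 1. The schema (model-free) -/

section General

variable {T : ThetaIndex} (S : LatticeSituation T) (P : Cor312.Setting S.toSituation)
  (ρ : (∀ v : T.V, v ∈ T.Vbad → Set (S.L.StarPacket v)) → ∀ (j : T.Label) (vQ : T.VQ), Set (S.L.Packet j vQ))
  (qK : ∀ v : T.V, v ∈ T.Vbad → Set (S.L.StarPacket v))

/-- **SCHEMA `TransporterCompat S P qK G` — print's datum clause with the transporter RESTRICTED TO THE CLASS `G`** (hypothesis schema, NOT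
asserted; typed ≠ proved): the q-pilot's Kummer datum `qK` IS the transport, along ONE packet-automorphism family `Φ ∈ G`, of the column-`m₀`
Kummer image of the Θ-pilot splitting monoid for SOME `m₀`. With `G = ⟨(Ind1) ∪ (Ind2)⟩` this is [IUTchIII] Thm. 3.11 (iii) (c), final clause,
p. 158 l. 5–14, read at the pilots (`Cor312Vol.PilotKummerCompat`); the class-(i) rows of sub-cell B0 are the instances with `G` cut down by an
[EtTh]-motivated constraint on the transporter's action on the theta data (Rmk. 2.2.1 (ii) p. 67 l. 39–49, Rmk. 2.2.2 (ii) p. 70 l. 33–36).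
A PARAMETRISED READING PREDICATE. [claim: Mochizuki2012, status: disputed] -/
@[claim "Mochizuki2012" "disputed"]
def TransporterCompat (G : Set S.L.PacketAut) : Prop :=
  ∃ Φ ∈ G, ∃ m₀ : ℤ, ∀ (v : T.V) (hv : v ∈ T.Vbad), qK v hv = S.L.starAut Φ v '' (S.col P.n).frobΨ m₀ v hv

/-- **`indShadow S P` — the Θ-SHADOW of the indeterminacy group**: the packet-automorphism families which act on EVERY column Kummer image
of the Θ-pilot splitting monoid `(S.col n).frobΨ m` as SOME element of `⟨(Ind1) ∪ (Ind2)⟩` does (possibly a different one for each `m`). It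
contains the indeterminacy group; a family outside the group lies in it iff its action on the theta data is indistinguishable from an
indeterminacy's — the only thing a datum-level class-(i) constraint can read. A PARAMETRISED SET; nothing asserted.
[claim: Mochizuki2012, status: disputed] -/
@[claim "Mochizuki2012" "disputed"]
def indShadow : Set S.L.PacketAut :=
  {Φ | ∀ m : ℤ, ∃ Φ' ∈ Subgroup.closure (S.L.Ind1Family ∪ S.L.Ind2Family), ∀ (v : T.V) (hv : v ∈ T.Vbad),
    S.L.starAut Φ v '' (S.col P.n).frobΨ m v hv = S.L.starAut Φ' v '' (S.col P.n).frobΨ m v hv}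

/-- Membership in the Θ-shadow, unfolded. [folklore] -/
theorem mem_indShadow_iff (Φ : S.L.PacketAut) :
    Φ ∈ indShadow S P ↔ ∀ m : ℤ, ∃ Φ' ∈ Subgroup.closure (S.L.Ind1Family ∪ S.L.Ind2Family), ∀ (v : T.V) (hv : v ∈ T.Vbad),
      S.L.starAut Φ v '' (S.col P.n).frobΨ m v hv = S.L.starAut Φ' v '' (S.col P.n).frobΨ m v hv :=
  Iff.rfl

/-- The schema is MONOTONE in the class: a larger transporter class gives a weaker hypothesis. [folklore] -/
theorem transporterCompat_mono {G G' : Set S.L.PacketAut} (hG : G ⊆ G') (h : TransporterCompat S P qK G) :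
    TransporterCompat S P qK G' := by
  obtain ⟨Φ, hΦ, m₀, hq⟩ := h
  exact ⟨Φ, hG hΦ, m₀, hq⟩

/-- **Print's clause is the instance `G = ⟨(Ind1) ∪ (Ind2)⟩`** ([IUTchIII] Thm. 3.11 (iii) (c) final clause p. 158 l. 5–14, at the pilots;
abc-iut-w5-d068 `Cor312Vol.PilotKummerCompat`). [claim: Mochizuki2012, status: disputed] -/
theorem pilotKummerCompat_iff_transporterCompat :
    PilotKummerCompat S P qK ↔
      TransporterCompat S P qK (Subgroup.closure (S.L.Ind1Family ∪ S.L.Ind2Family) : Set S.L.PacketAut) := by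
  constructor
  · rintro ⟨Φ, hΦ, m₀, hq⟩
    exact ⟨Φ, hΦ, m₀, hq⟩
  · rintro ⟨Φ, hΦ, m₀, hq⟩
    exact ⟨Φ, hΦ, m₀, hq⟩

/-- The indeterminacy group lies in its Θ-shadow (`Φ' = Φ`). [folklore] -/
theorem closure_subset_indShadow :
    (Subgroup.closure (S.L.Ind1Family ∪ S.L.Ind2Family) : Set S.L.PacketAut) ⊆ indShadow S P :=
  fun Φ hΦ _ => ⟨Φ, hΦ, fun _ _ => rfl⟩

/-- **THE Λ-BINDER ELIMINATED, once for all rows.** A class-(i) Λ-row of the shape «every family `Φ ∈ Λ` through which a link isomorphism acts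
on the containers has property `g`» ∧ RF1 «`qK` is the `Λ`-transport of a column Kummer image of the Θ-pilot splitting monoid» is — the
uninterpreted binder `Λ` quantified away — EXACTLY the schema at the class `{Φ | g Φ}`. (Rows RP-I03a/b, RP-I13, RP-I19 are instances, below.)
[folklore] -/
theorem exists_pointwise_and_transport_iff (g : S.L.PacketAut → Prop) :
    (∃ Λ : Set S.L.PacketAut, (∀ Φ ∈ Λ, g Φ) ∧ ∃ Φ₀ ∈ Λ, ∃ m₀ : ℤ, ∀ (v : T.V) (hv : v ∈ T.Vbad),
        qK v hv = S.L.starAut Φ₀ v '' (S.col P.n).frobΨ m₀ v hv) ↔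
      TransporterCompat S P qK {Φ | g Φ} := by
  constructor
  · rintro ⟨Λ, hΛ, Φ₀, hΦ₀, m₀, hq⟩
    exact ⟨Φ₀, hΛ Φ₀ hΦ₀, m₀, hq⟩
  · rintro ⟨Φ, hΦ, m₀, hq⟩
    exact ⟨{Φ}, fun Ψ hΨ => by rw [Set.mem_singleton_iff.mp hΨ]; exact hΦ, Φ, rfl, m₀, hq⟩

/-! ### The four d1 suppliers as instances of the schema -/

/-- **Row RP-I03a ∧ RF1, `Λ` bound** (`CandInternal1.H`, ⟨Ind2⟩-translates on the Θ data; p427501) = the schema at the class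
`G_I03a = {Φ | ∀ m, ∃ Φ' ∈ ⟨Ind2⟩, Φ·frobΨ m = Φ'·frobΨ m}`. [claim: Mochizuki2012, status: disputed] -/
theorem rowI03a_iff :
    (∃ Λ : Set S.L.PacketAut, CandInternal1.H S P Λ ∧ ∃ Φ₀ ∈ Λ, ∃ m₀ : ℤ, ∀ (v : T.V) (hv : v ∈ T.Vbad),
        qK v hv = S.L.starAut Φ₀ v '' (S.col P.n).frobΨ m₀ v hv) ↔
      TransporterCompat S P qK {Φ | ∀ m : ℤ, ∃ Φ' ∈ Subgroup.closure S.L.Ind2Family, ∀ (v : T.V) (hv : v ∈ T.Vbad),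
        S.L.starAut Φ v '' (S.col P.n).frobΨ m v hv = S.L.starAut Φ' v '' (S.col P.n).frobΨ m v hv} :=
  exists_pointwise_and_transport_iff S P qK _

/-- **Row RP-I03b ∧ RF1, `Λ` bound** (`CandInternal1.Hins`, the insulated form; p427501) = the schema at `G_I03b = {Φ | Φ fixes every column
Kummer image of the Θ-pilot splitting monoid}`. [claim: Mochizuki2012, status: disputed] -/
theorem rowI03b_iff :
    (∃ Λ : Set S.L.PacketAut, CandInternal1.Hins S P Λ ∧ ∃ Φ₀ ∈ Λ, ∃ m₀ : ℤ, ∀ (v : T.V) (hv : v ∈ T.Vbad),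
        qK v hv = S.L.starAut Φ₀ v '' (S.col P.n).frobΨ m₀ v hv) ↔
      TransporterCompat S P qK {Φ | ∀ (m : ℤ) (v : T.V) (hv : v ∈ T.Vbad),
        S.L.starAut Φ v '' (S.col P.n).frobΨ m v hv = (S.col P.n).frobΨ m v hv} :=
  exists_pointwise_and_transport_iff S P qK _

/-- **Row RP-I13 ∧ RF1, `Λ` bound** (`CandInternal10.H`: `Λ ⊆ ⟨Ind2⟩`, radial/coric decoupling; p428974) = the schema at `G_I13 = ⟨Ind2⟩`
(re-derivation of `CandInternal10.exists_H_and_linkTransport_iff` as an instance). [claim: Mochizuki2012, status: disputed] -/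
theorem rowI13_iff :
    (∃ Λ : Set S.L.PacketAut, CandInternal10.H S Λ ∧ ∃ Φ₀ ∈ Λ, ∃ m₀ : ℤ, ∀ (v : T.V) (hv : v ∈ T.Vbad),
        qK v hv = S.L.starAut Φ₀ v '' (S.col P.n).frobΨ m₀ v hv) ↔
      TransporterCompat S P qK (Subgroup.closure S.L.Ind2Family : Set S.L.PacketAut) := by
  rw [CandInternal10.exists_H_and_linkTransport_iff]
  constructor
  · rintro ⟨Φ, hΦ, m₀, hq⟩
    exact ⟨Φ, hΦ, m₀, hq⟩
  · rintro ⟨Φ, hΦ, m₀, hq⟩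
    exact ⟨Φ, hΦ, m₀, hq⟩

/-- **Row RP-I19 joint form, `Λ` bound** (`CandInternal34.HTor ∧ (LI) ∧ RF1`, roots-of-unity reading; p437377/p439997) = the schema at
`G_I19 = {Φ ∈ ⟨(Ind1) ∪ (Ind2)⟩ | some power Φ^N, N ≥ 1, fixes every column Kummer image}` (re-derivation of
`CandInternal52.exists_HTor_linkSubInd_transport_iff` as an instance). [claim: Mochizuki2012, status: disputed] -/
theorem rowI19_iff :
    (∃ Λ : Set S.L.PacketAut, CandInternal34.HTor S P Λ ∧
        Λ ⊆ (Subgroup.closure (S.L.Ind1Family ∪ S.L.Ind2Family) : Set S.L.PacketAut) ∧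
        ∃ Φ₀ ∈ Λ, ∃ m₀ : ℤ, ∀ (v : T.V) (hv : v ∈ T.Vbad), qK v hv = S.L.starAut Φ₀ v '' (S.col P.n).frobΨ m₀ v hv) ↔
      TransporterCompat S P qK {Φ | Φ ∈ Subgroup.closure (S.L.Ind1Family ∪ S.L.Ind2Family) ∧
        ∃ N : ℕ, 0 < N ∧ ∀ (m : ℤ) (v : T.V) (hv : v ∈ T.Vbad),
          S.L.starAut (Φ ^ N) v '' (S.col P.n).frobΨ m v hv = (S.col P.n).frobΨ m v hv} := by
  rw [CandInternal52.exists_HTor_linkSubInd_transport_iff]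
  constructor
  · rintro ⟨Φ, hΦ, hN, m₀, hq⟩
    exact ⟨Φ, ⟨hΦ, hN⟩, m₀, hq⟩
  · rintro ⟨Φ, ⟨hΦ, hN⟩, m₀, hq⟩
    exact ⟨Φ, hΦ, hN, m₀, hq⟩

/-! ## 2. Sufficiency through the Θ-shadow; the maximal class is print's clause -/

/-- **`pilotKummerCompat_of_transporterCompat`**: a transporter class INSIDE THE Θ-SHADOW gives print's clause — replace the transporter by an
indeterminacy with the same action on the transported Kummer image. (This is the one mechanism behind every d1 T-a PASS:
`CandInternal1.pilotKummerCompat_of_H_of_linkTransport`, `CandInternal10.pilotKummerCompat_of_H_of_linkTransport`,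
`CandInternal52.pilotKummerCompat_of_finiteOrderTransport`.) [claim: Mochizuki2012, status: disputed] -/
theorem pilotKummerCompat_of_transporterCompat {G : Set S.L.PacketAut} (hG : G ⊆ indShadow S P)
    (h : TransporterCompat S P qK G) : PilotKummerCompat S P qK := by
  obtain ⟨Φ, hΦ, m₀, hq⟩ := h
  obtain ⟨Φ', hΦ', he⟩ := hG hΦ m₀
  exact ⟨Φ', hΦ', m₀, fun v hv => by rw [hq v hv, he v hv]⟩

/-- **THE MAXIMAL CLASS GIVES BACK EXACTLY PRINT'S CLAUSE**: `TransporterCompat (indShadow) ⟺ PilotKummerCompat`. So every transporter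
constraint that supplies S through its action on the theta data is a SUB-CLASS of print's clause — never weaker than it.
[claim: Mochizuki2012, status: disputed] -/
theorem transporterCompat_indShadow_iff :
    TransporterCompat S P qK (indShadow S P) ↔ PilotKummerCompat S P qK :=
  ⟨pilotKummerCompat_of_transporterCompat S P qK (fun _ h => h), fun h =>
    transporterCompat_mono S P qK (closure_subset_indShadow S P) ((pilotKummerCompat_iff_transporterCompat S P qK).1 h)⟩

/-- … hence the printed Statement of Cor. 3.12 through the vehicle V-C (`Cor312Vol.statement_of_pilotKummerCompat`: bridge hypotheses + the
three pins). CONDITIONAL on the schema instance as typed; nothing more. [claim: Mochizuki2012, status: disputed] -/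
theorem statement_of_transporterCompat (HB : BridgeHyps P) (hpin : PinnedRegions3 S P ρ qK) {G : Set S.L.PacketAut}
    (hG : G ⊆ indShadow S P) (h : TransporterCompat S P qK G) : P.Statement :=
  statement_of_pilotKummerCompat S P ρ qK HB hpin (pilotKummerCompat_of_transporterCompat S P qK hG h)

/-- … and the director's literal object S under Thm. 3.11 (ii) (b) for the column. [claim: Mochizuki2012, status: disputed] -/
theorem pilotKummerIndRelated_of_transporterCompat (hKumB : (S.col P.n).KummerB (S.D P.n)) {G : Set S.L.PacketAut}
    (hG : G ⊆ indShadow S P) (h : TransporterCompat S P qK G) : PilotKummerIndRelated S P ρ qK :=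
  pilotKummerIndRelated_of_pilotKummerCompat S P ρ qK hKumB (pilotKummerCompat_of_transporterCompat S P qK hG h)

/-- **All four d1 classes lie in the Θ-shadow** (so §2/§4 apply to them uniformly): `G_I13 = ⟨Ind2⟩`, `G_I03a` (⟨Ind2⟩-translates on the Θ data),
`G_I03b` (fixes the Θ data; `Φ' = 1`), `G_I19 ⊆ ⟨(Ind1) ∪ (Ind2)⟩`. [folklore] -/
theorem rowClasses_subset_indShadow :
    (Subgroup.closure S.L.Ind2Family : Set S.L.PacketAut) ⊆ indShadow S P ∧
    {Φ : S.L.PacketAut | ∀ m : ℤ, ∃ Φ' ∈ Subgroup.closure S.L.Ind2Family, ∀ (v : T.V) (hv : v ∈ T.Vbad),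
        S.L.starAut Φ v '' (S.col P.n).frobΨ m v hv = S.L.starAut Φ' v '' (S.col P.n).frobΨ m v hv} ⊆ indShadow S P ∧
    {Φ : S.L.PacketAut | ∀ (m : ℤ) (v : T.V) (hv : v ∈ T.Vbad),
        S.L.starAut Φ v '' (S.col P.n).frobΨ m v hv = (S.col P.n).frobΨ m v hv} ⊆ indShadow S P ∧
    {Φ : S.L.PacketAut | Φ ∈ Subgroup.closure (S.L.Ind1Family ∪ S.L.Ind2Family) ∧
        ∃ N : ℕ, 0 < N ∧ ∀ (m : ℤ) (v : T.V) (hv : v ∈ T.Vbad),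
          S.L.starAut (Φ ^ N) v '' (S.col P.n).frobΨ m v hv = (S.col P.n).frobΨ m v hv} ⊆ indShadow S P := by
  refine ⟨fun Φ hΦ _ => ⟨Φ, Subgroup.closure_mono Set.subset_union_right hΦ, fun _ _ => rfl⟩, fun Φ hΦ m => ?_,
    fun Φ hΦ m => ⟨1, one_mem _, fun v hv => by rw [hΦ m v hv, LogShells.starAut_one]; simp⟩,
    fun Φ hΦ _ => ⟨Φ, hΦ.1, fun _ _ => rfl⟩⟩
  obtain ⟨Φ', hΦ', he⟩ := hΦ m
  exact ⟨Φ', Subgroup.closure_mono Set.subset_union_right hΦ', he⟩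

end General

/-! ## 2b. Test (a) for the whole schema, in the barrier track's vocabulary -/

section Tests

variable (𝒢 : ∀ (T : ThetaIndex) (F : FullSituation T) (_P : Cor312.Setting F.toLatticeSituation.toSituation), Set F.L.PacketAut)

/-- **T-a for the schema: a class assignment inside the Θ-shadow everywhere is SUFFICIENT** (abc-iut-rp-bar `Repair.Sufficient`, through
`Repair.pilotKummerCompat_sufficient`): it passes the director's test (a) — and by `pilotKummerCompat_of_transporterCompat` it does so only by
being a sub-class of print's clause. [claim: Mochizuki2012, status: disputed] -/
theorem sufficient_of_subset_indShadow
    (h𝒢 : ∀ (T : ThetaIndex) (F : FullSituation T) (P : Cor312.Setting F.toLatticeSituation.toSituation),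
      𝒢 T F P ⊆ indShadow F.toLatticeSituation P) :
    Sufficient fun T F P _ qK => TransporterCompat F.toLatticeSituation P qK (𝒢 T F P) :=
  fun T F P ρ qK hF hMR HB hq hadm hpin h =>
    pilotKummerCompat_sufficient T F P ρ qK hF hMR HB hq hadm hpin
      (pilotKummerCompat_of_transporterCompat F.toLatticeSituation P qK (h𝒢 T F P) h)

end Tests

end CandInternal55

end Summit.ABC.IUTFork.Repair
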